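import Summits.BirchSwinnertonDyer.BirchSwinnertonDyer.Theorems.KolyvaginDepthDoorMSymbolCert997c1Odd
import Summits.BirchSwinnertonDyer.BirchSwinnertonDyer.Theorems.KolyvaginDepthDoorMSymbolCert389a1Twist
import Summits.BirchSwinnertonDyer.BirchSwinnertonDyer.Theorems.KolyvaginDepthDoorMSymbolCert997b1Twist
import Summits.BirchSwinnertonDyer.BirchSwinnertonDyer.Theorems.KolyvaginDepthDoorDepthTableRankTwo997c1Neg23TwistBSDQuotient
import Summits.BirchSwinnertonDyer.BirchSwinnertonDyer.Theorems.KatoDescentTamePotSupersingularTameUpperUnitTwistRecordToolsConductor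
import Literature.NumberTheory.EllipticCurves.CuspFormTwistRatPlusSymbolOdd
import Literature.NumberTheory.EllipticCurves.QuadraticTwistKroneckerLFunctionProofs
import Literature.NumberTheory.QuadraticFields.JacobiCharacterPrimitiveProofs
import Literature.NumberTheory.EllipticCurves.LFunctionSmulProofs
import Literature.NumberTheory.EllipticCurves.ModularityVersionApProofs
import HarnessLib

/-!
# Route `KolyvaginDepthDoor`, crux `KolyvaginDepthSupplyKN` (stmt-BirchSwinnertonDyer-22820) —
# DEPTH TABLE v28, TWIST SIDE of row `997c1` @ `(7, −23)`: the plus symbols of the newform of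
# `T₀ = 997c1 ⊗ χ₋₂₃` (conductor `527413 = 23²·997`) from the CERTIFIED minus M-symbol of `997c1`

Helper file of the lead prover of line `levelone` (kdd-p1 g33; `--supports stmt-BirchSwinnertonDyer-22820
--as helper`); it closes nothing and BSD is NOT proved by it. The file is the row-`997c1` / field-`ℚ(√−23)` sibling of
`…MSymbolCert709a1Twist` (same argument; the twisting character is now `χ₋₂₃ = (·/23)`, odd and primitive):
* `conductorNorm_T0`: `N_{T₀} = 527413 = 23²·997` for the globally minimal twist model `T₀ = ⟨0, -1, 1, -12872, -557532⟩` of the tree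
  (`C997c1.minTwist23_*`, g19) (kernel: Tate exponents `f₂₃ = 2`, `f_997 = 1` from `Δ(T₀) = 23⁶·997`, `23 ∣ c₄`, `997 ∤ c₄`);
* `LFunction_T0`: `aₙ(T₀) = (n/23) aₙ(997c1)`, hence `newform_T0_eq_charTwist`: the newform of `T₀` at level `527413` is
  `charTwist 527413 … (jacobiChar 23) f₀` for the newform `f₀` of `997c1`;
* `exists_ratMinusSymbol_const`: `[y]⁻_{f₀} ∈ K₀ ℤ` and `[a/n]⁻_{f₀} = K₀ · S⁻(a/n)` (certified odd eigenvector
  `…MSymbolCert997c1Odd`, from `IsNewformOf` only);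
* `exists_const_T0`: ONE rational `C` with `[r]⁺_g ∈ C ℤ` for all `r` and `[a/239]⁺_g = C · sigmaT a`
  (`0 < a < 239`), `sigmaT a = ∑_{u=1}^{22} (u/23) S⁻((23a + 239u)/5497)` (Mazur–Tate–Teitelbaum §I.8 twist formula,
  `exists_rat_forall_ratPlusSymbol_charTwist_eq_of_odd`) — `239` is the decisive Kolyvagin prime of the row (DECISIVE-RESIDUES-v20).
Modularity of `997c1` enters as the row's hypothesis `exists_isNewformOf` (`hnf`).

References: [MazurTateTeitelbaum1986Invent] §I.8; [Shimura1971] Prop. 3.64; [CremonaAlgorithms1997] §2.8,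
Table 1 (997c1); [SilvermanAEC2009] App. C §16 (conductor), X.5 Cor. 5.4 (twists).
-/

set_option linter.dupNamespace false

noncomputable section

open scoped MatrixGroups ModularForm
open CongruenceSubgroup
open Literature.NumberTheory.EllipticCurves Literature.NumberTheory.EllipticCurves.ModularForms
open Literature.NumberTheory.QuadraticFields
open Summit.BirchSwinnertonDyer.BirchSwinnertonDyer.Rank2Observatory
open Summit.BirchSwinnertonDyer.BirchSwinnertonDyer.Theorems.TameUpperUnitTwistRecords
  (conductorNorm_eq_of_exponents conductorExponent_natPlace_eq_two_of_five_le
    conductorExponent_natPlace_eq_one_of_dvd_of_not_dvd)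
open Summit.BirchSwinnertonDyer.BirchSwinnertonDyer.Rank1Residual (IntModel.frobeniusTrace_eq)
open Summit.BirchSwinnertonDyer.BirchSwinnertonDyer.Theorems.KolyvaginDepthDoor.MSymbolCert.Cert997b1
  (dvd_527413 sq_dvd_527413 jacobiChar_23_odd jacobiChar_23_isPrimitive jac23 jac23_eq)

namespace Summit.BirchSwinnertonDyer.BirchSwinnertonDyer.Theorems.KolyvaginDepthDoor.MSymbolCert.Cert997c1

/-! ## §1 `T₀` and its conductor `527413 = 23²·997` -/

/-- The globally minimal model `T₀` of `997c1^{(-23)}` (the tree's `C997c1.minTwist23_*`, conductor `23²·997`).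
[cite: CremonaAlgorithms1997, Table 1 (997c1)] -/
abbrev T0 : WeierstrassCurve ℚ := (⟨0, -1, 1, -12872, -557532⟩ : WeierstrassCurve ℤ).map (Int.castRingHom ℚ)

/-- **`N(T₀) = 527413 = 23² · 997`** (kernel: `Δ(T₀) = 23⁶ · 997`, `23 ∣ c₄ = 617872` so `f₂₃ = 2`, `997 ∤ c₄` so
`f_997 = 1`; the tree's `conductorNorm_eq_of_exponents`). [cite: SilvermanAEC2009, App. C §16] -/
theorem conductorNorm_T0 : haveI := C997c1.minTwist23_isElliptic; T0.conductorNorm ℤ = 527413 := by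
  haveI := C997c1.minTwist23_isElliptic
  haveI := C997c1.minTwist23_isGloballyMinimal
  have hI := C997c1.minTwist23_intModel
  have h := conductorNorm_eq_of_exponents hI (G := [(23, 6), (997, 1)]) (by decide +kernel)
    (by intro qe hqe; simp only [List.mem_cons, List.not_mem_nil, or_false] at hqe
        rcases hqe with rfl | rfl <;> norm_num)
    [(23, 2), (997, 1)]
    (by intro qf hqf; simp only [List.mem_cons, List.not_mem_nil, or_false] at hqf
        rcases hqf with rfl | rfl <;> norm_num)
    (by decide) (by decide)
    (by
      intro qf hqf
      simp only [List.mem_cons, List.not_mem_nil, or_false] at hqf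
      rcases hqf with rfl | rfl
      · exact conductorExponent_natPlace_eq_two_of_five_le hI (by norm_num) (by norm_num) (n := 6) (by norm_num)
          (by decide +kernel) (by decide +kernel) (by norm_num) (by decide +kernel)
      · exact conductorExponent_natPlace_eq_one_of_dvd_of_not_dvd hI (by norm_num) (by decide +kernel) (by decide +kernel))
  rw [h]; norm_num

/-! ## §3 The Dirichlet coefficients of `T₀` -/

/-- **`aₙ(T₀) = (n/23) · aₙ(997c1)`** (`T₀ ≅ 997c1^{(-23)}` by `C997c1.minTwist23_smul_eq`, `-23 ≡ 1 (mod 4)`,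
`997c1` good at `23`). [cite: SilvermanAEC2009, X.5 Cor. 5.4] -/
theorem LFunction_T0 (n : ℕ) :
    haveI := C997c1.minTwist23_isElliptic; haveI := isElliptic_c997c1;
    (T0.LFunction n : ℂ) = jacobiChar 23 n * ((((⟨0, -1, 1, -24, 54⟩ : WeierstrassCurve ℤ).map (Int.castRingHom ℚ))).LFunction n : ℂ) := by
  haveI := C997c1.minTwist23_isElliptic
  haveI := isElliptic_c997c1
  haveI := isGloballyMinimal_c997c1
  have hsmul := WeierstrassCurve.LFunction_smul T0 (⟨1, (8 : ℚ), (0 : ℚ), -((1 : ℚ) / 2)⟩ : WeierstrassCurve.VariableChange ℚ)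
  rw [C997c1.minTwist23_smul_eq] at hsmul
  have hgood : ∀ v : IsDedekindDomain.HeightOneSpectrum (NumberField.RingOfIntegers ℚ),
      ((Rat.HeightOneSpectrum.primesEquiv v : ℕ) : ℤ) ∣ (-23 : ℤ) → (((⟨0, -1, 1, -24, 54⟩ : WeierstrassCurve ℤ).map (Int.castRingHom ℚ))).HasGoodReductionAt v := by
    intro v hv
    by_contra hbad
    have hdvdN : (Rat.HeightOneSpectrum.primesEquiv v : ℕ) ∣ (((⟨0, -1, 1, -24, 54⟩ : WeierstrassCurve ℤ).map (Int.castRingHom ℚ))).conductorNorm ℤ :=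
      ((((⟨0, -1, 1, -24, 54⟩ : WeierstrassCurve ℤ).map (Int.castRingHom ℚ))).dvd_conductorNorm_iff v).mpr hbad
    rw [C997c1.conductorNorm_eq] at hdvdN
    have h23 : (Rat.HeightOneSpectrum.primesEquiv v : ℕ) ∣ 23 := by
      have : ((Rat.HeightOneSpectrum.primesEquiv v : ℕ) : ℤ) ∣ ((23 : ℕ) : ℤ) := by simpa using hv
      exact_mod_cast this
    have hp := (Rat.HeightOneSpectrum.primesEquiv v).2
    have h23' : (Rat.HeightOneSpectrum.primesEquiv v : ℕ) = 23 :=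
      (Nat.prime_dvd_prime_iff_eq hp (by norm_num)).mp h23
    rw [h23'] at hdvdN
    norm_num at hdvdN
  have hsq : Squarefree (-23 : ℤ) := by
    rw [← Int.squarefree_natAbs]
    exact (Nat.prime_iff.mp (by norm_num : Nat.Prime 23)).squarefree
  have htw := (((⟨0, -1, 1, -24, 54⟩ : WeierstrassCurve ℤ).map (Int.castRingHom ℚ))).LFunction_quadraticTwist_apply_of_emod_four_eq_one (D := -23) (by decide) hsq hgood n
  rw [show (((-23 : ℤ) : ℚ)) = (-23 : ℚ) by norm_num] at htw
  rw [← hsmul, htw, jacobiChar_natCast]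
  push_cast
  rfl

/-! ## §4 The newform of `T₀` is the twist of the newform of `997c1` -/

/-- **The newform of `T₀` at level `527413` is `f₀ ⊗ χ₋₂₃`** for the newform `f₀` of `997c1` (q-expansion principle).
[cite: Shimura1971, Prop. 3.64] -/
theorem newform_T0_eq_charTwist (f₀ : CuspForm (Gamma0 997) 2)
    (hf₀ : haveI := isElliptic_c997c1; IsNewformOf (((⟨0, -1, 1, -24, 54⟩ : WeierstrassCurve ℤ).map (Int.castRingHom ℚ))) f₀)
    (g : CuspForm (Gamma0 527413) 2) (hg : haveI := C997c1.minTwist23_isElliptic; IsNewformOf T0 g) :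
    g = charTwist 527413 dvd_527413 sq_dvd_527413 (isQuadratic_jacobiChar (q := 23)) f₀ := by
  haveI := isElliptic_c997c1
  refine eq_of_forall_cuspCoeff_eq_gamma0 fun n => ?_
  rw [cuspCoeff_charTwist _ _ _ _ jacobiChar_23_isPrimitive, hf₀.2 n, hg.2 n, LFunction_T0]

/-! ## §5 The minus symbols of the newform of `997c1` (from the certified odd eigenvector) -/

/-- `T₃ f₀ = -1 f₀` for the newform of `997c1` at level `997` (`#Ẽ(𝔽₃) = 5`, kernel point count).
[cite: CremonaAlgorithms1997, Table 1 (997c1)] -/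
theorem heckeT3_of_isNewformOf (f₀ : CuspForm (Gamma0 997) 2)
    (hf₀ : haveI := isElliptic_c997c1; IsNewformOf (((⟨0, -1, 1, -24, 54⟩ : WeierstrassCurve ℤ).map (Int.castRingHom ℚ))) f₀) :
    heckeTnGamma0 997 2 3 f₀ = ((-1 : ℝ) : ℂ) • f₀ := by
  haveI : Fact (Nat.Prime 3) := ⟨by norm_num⟩
  haveI : NeZero (3 : ℕ) := ⟨by norm_num⟩
  haveI := isElliptic_c997c1
  haveI := isGloballyMinimal_c997c1
  have hgood : (((⟨0, -1, 1, -24, 54⟩ : WeierstrassCurve ℤ).map (Int.castRingHom ℚ))).HasGoodReductionAtPrime 3 :=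
    (goodOrdinary_of_intModel_certificate C997c1.intModel 3 (by decide +kernel) (n := 5) C997c1.card_3
      (by decide +kernel)).1
  have hc : cuspCoeff f₀ 3 = ((((⟨0, -1, 1, -24, 54⟩ : WeierstrassCurve ℤ).map (Int.castRingHom ℚ))).frobeniusTrace 3 : ℂ) :=
    cuspCoeff_eq_frobeniusTrace_of_isNewformOf_holds hf₀ hgood
  have htr : (((⟨0, -1, 1, -24, 54⟩ : WeierstrassCurve ℤ).map (Int.castRingHom ℚ))).frobeniusTrace 3 = -1 := by
    rw [IntModel.frobeniusTrace_eq C997c1.intModel C997c1.card_3]; norm_num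
  rw [heckeTnGamma0_prime 997 2 3 (by norm_num), IsNewform0.heckeT_eq_coeff_smul hf₀.1 (by norm_num),
    show (PowerSeries.coeff 3) (UpperHalfPlane.qExpansion 1 ⇑f₀) = cuspCoeff f₀ 3 from rfl, hc, htr]
  push_cast
  rfl

/-- `T₅ f₀ = -2 f₀` for the newform of `997c1` at level `997` (`#Ẽ(𝔽₅) = 8`, kernel point count).
[cite: CremonaAlgorithms1997, Table 1 (997c1)] -/
theorem heckeT5_of_isNewformOf (f₀ : CuspForm (Gamma0 997) 2)
    (hf₀ : haveI := isElliptic_c997c1; IsNewformOf (((⟨0, -1, 1, -24, 54⟩ : WeierstrassCurve ℤ).map (Int.castRingHom ℚ))) f₀) :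
    heckeTnGamma0 997 2 5 f₀ = ((-2 : ℝ) : ℂ) • f₀ := by
  haveI : Fact (Nat.Prime 5) := ⟨by norm_num⟩
  haveI : NeZero (5 : ℕ) := ⟨by norm_num⟩
  haveI := isElliptic_c997c1
  haveI := isGloballyMinimal_c997c1
  have hgood : (((⟨0, -1, 1, -24, 54⟩ : WeierstrassCurve ℤ).map (Int.castRingHom ℚ))).HasGoodReductionAtPrime 5 :=
    (goodOrdinary_of_intModel_certificate C997c1.intModel 5 (by decide +kernel) (n := 8) C997c1.card_5
      (by decide +kernel)).1
  have hc : cuspCoeff f₀ 5 = ((((⟨0, -1, 1, -24, 54⟩ : WeierstrassCurve ℤ).map (Int.castRingHom ℚ))).frobeniusTrace 5 : ℂ) :=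
    cuspCoeff_eq_frobeniusTrace_of_isNewformOf_holds hf₀ hgood
  have htr : (((⟨0, -1, 1, -24, 54⟩ : WeierstrassCurve ℤ).map (Int.castRingHom ℚ))).frobeniusTrace 5 = -2 := by
    rw [IntModel.frobeniusTrace_eq C997c1.intModel C997c1.card_5]; norm_num
  rw [heckeTnGamma0_prime 997 2 5 (by norm_num), IsNewform0.heckeT_eq_coeff_smul hf₀.1 (by norm_num),
    show (PowerSeries.coeff 5) (UpperHalfPlane.qExpansion 1 ⇑f₀) = cuspCoeff f₀ 5 from rfl, hc, htr]
  push_cast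
  rfl

/-- **`[y]⁻_{f₀} ∈ K₀ ℤ` and `[a/n]⁻_{f₀} = K₀ · S⁻(a/n)`** for the newform `f₀` of `997c1`, ONE rational `K₀`:
the certified odd eigenvector (`certOdd997c1_check`, `poolOdd_holds`, kit 5), periodicity for integral `y`.
[cite: MazurTateTeitelbaum1986Invent, §I.8] -/
theorem exists_ratMinusSymbol_const (f₀ : CuspForm (Gamma0 997) 2)
    (hf₀ : haveI := isElliptic_c997c1; IsNewformOf (((⟨0, -1, 1, -24, 54⟩ : WeierstrassCurve ℤ).map (Int.castRingHom ℚ))) f₀) :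
    ∃ K₀ : ℚ, (∀ y : ℚ, ∃ k : ℤ, ratMinusSymbol f₀ y = K₀ * k) ∧
      ∀ (a w : ℤ) (n : ℕ), 0 < n → a * w % n = 1 → ∀ fuel : ℕ, n < fuel →
        ratMinusSymbol f₀ ((a : ℚ) / n) = K₀ * chainSum 997 phim997c1 fuel n w := by
  haveI := isElliptic_c997c1
  have hreal : ∀ m, (cuspCoeff f₀ m).im = 0 := cuspCoeff_im_eq_zero_of_coeffField_eq_bot hf₀.coeffField_eq_bot
  have hF : ∀ k < 4990, eval (Ψm f₀) (genOdd997c1 k) = 0 := fun k _ =>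
    poolOdd_holds f₀ hreal (heckeT3_of_isNewformOf f₀ hf₀) (heckeT5_of_isNewformOf f₀ hf₀) k
  obtain ⟨t, ht⟩ := exists_eq_smul_of_checkF certOdd997c1 genOdd997c1 4990 998 phim997c1 certOdd997c1_check (Ψm f₀) hF
  obtain ⟨g, ε, hg, hε, hval⟩ :=
    exists_ratMinusSymbol_eq f₀ hf₀.1 hf₀.coeffField_eq_bot (fun i hi => ht i (by omega))
  refine ⟨(ε : ℚ) / (2 * g), fun y => ?_, fun a w n hn hw fuel hfuel => by rw [hval a w n hn hw fuel hfuel]; ring⟩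
  by_cases hden : y.den = 1
  · refine ⟨0, ?_⟩
    have hy : y = ((y.num : ℚ)) := by
      conv_lhs => rw [← Rat.num_div_den y]
      rw [hden]; simp
    rw [hy, show ((y.num : ℚ)) = 0 + (y.num : ℚ) by ring, ratMinusSymbol_add_intCast, ratMinusSymbol_zero]
    simp
  · have hcop : IsCoprime y.num (y.den : ℤ) := by
      rw [Int.isCoprime_iff_gcd_eq_one]
      exact y.reduced
    obtain ⟨u, v, huv⟩ := hcop
    have hden1 : (1 : ℤ) < y.den := by
      have := y.den_pos
      omega
    have hw : y.num * u % (y.den : ℤ) = 1 := by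
      have : y.num * u = 1 + (y.den : ℤ) * (-v) := by linarith
      rw [this, Int.add_mul_emod_self_left, Int.emod_eq_of_lt (by norm_num) hden1]
    refine ⟨chainSum 997 phim997c1 (y.den + 1) y.den u, ?_⟩
    have h := hval y.num u y.den y.den_pos hw (y.den + 1) (by omega)
    rw [Rat.num_div_den] at h
    rw [h]
    ring

/-! ## §6 The plus symbols of the newform of `T₀` at the cusps `a/239` -/

/-- The Bezout witness `(23a + 239u)^{2617} mod 5497` (an inverse of `23a + 239u` modulo `5497 = 23·239`). [folklore] -/
def bezT (a u : ℕ) : ℤ := (((23 * a + 239 * u) ^ 2617 % 5497 : ℕ) : ℤ)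

/-- The kernel's twisted minus sum at `r = a/239`: `∑_{u=1}^{22} (u/23) · S⁻((23a + 239u)/5497)`.
[cite: MazurTateTeitelbaum1986Invent, §I.8] -/
def sigmaT (a : ℕ) : ℤ :=
  ∑ u : ZMod 23, (if u.val = 0 then 0 else jac23 u.val * chainSum 997 phim997c1 5498 5497 (bezT a u.val))

set_option maxHeartbeats 4000000 in
/-- Bezout data at `5497 = 23 · 239` (decide): `x · (x^{2617} mod 5497) ≡ 1` for `x = 23a + 239u`, `0 < a < 239`,
`1 ≤ u ≤ 22`. [folklore] -/
theorem bezout_5497 : ∀ a < 239, Nat.Coprime a 239 → ∀ u < 23, u ≠ 0 →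
    (((23 * a + 239 * u : ℕ) : ℤ) * bezT a u) % 5497 = 1 := by
  unfold bezT
  decide +kernel

/-- A modular parametrisation newform of `997c1` at level `997` exists, granted modularity BY NAME
(`exists_isNewformOf`; `N(997c1) = 997`). [cite: BreuilConradDiamondTaylor2001, Thm. A] -/
theorem exists_newform_997c1 (hnf : exists_isNewformOf) :
    haveI := isElliptic_c997c1;
    ∃ f₀ : CuspForm (Gamma0 997) 2, IsNewformOf (((⟨0, -1, 1, -24, 54⟩ : WeierstrassCurve ℤ).map (Int.castRingHom ℚ))) f₀ := by
  haveI := isElliptic_c997c1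
  haveI : NeZero ((((⟨0, -1, 1, -24, 54⟩ : WeierstrassCurve ℤ).map (Int.castRingHom ℚ))).conductorNorm ℤ) := neZero_conductorNorm_of_isElliptic _
  suffices h : ∀ L : ℕ, L = (((⟨0, -1, 1, -24, 54⟩ : WeierstrassCurve ℤ).map (Int.castRingHom ℚ))).conductorNorm ℤ → ∀ [NeZero L],
      ∃ f₀ : CuspForm (Gamma0 L) 2, IsNewformOf (((⟨0, -1, 1, -24, 54⟩ : WeierstrassCurve ℤ).map (Int.castRingHom ℚ))) f₀ from
    h 997 C997c1.conductorNorm_eq.symm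
  intro L hL _
  subst hL
  exact hnf _

/-- **The plus symbols of the newform `g` of `T₀` at level `527413`**: ONE rational `C` with `[r]⁺_g ∈ C ℤ` for
all `r` and `[a/239]⁺_g = C · sigmaT a` for `0 < a < 239` — the twist formula
(`exists_rat_forall_ratPlusSymbol_charTwist_eq_of_odd`, `χ₋₂₃` odd primitive quadratic) and the certified minus
symbols of `f₀` (`exists_ratMinusSymbol_const`); modularity of `997c1` by name (`hnf`).
[cite: MazurTateTeitelbaum1986Invent, §I.8] [cite: Shimura1971, Prop. 3.64] -/
theorem exists_const_T0 (hnf : exists_isNewformOf) (g : CuspForm (Gamma0 527413) 2)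
    (hg : haveI := C997c1.minTwist23_isElliptic; IsNewformOf T0 g) :
    ∃ C : ℚ, (∀ r : ℚ, ∃ m : ℤ, ratPlusSymbol g r = C * m) ∧
      ∀ a < 239, Nat.Coprime a 239 → ratPlusSymbol g ((a : ℚ) / 239) = C * sigmaT a := by
  haveI := C997c1.minTwist23_isElliptic
  haveI := isElliptic_c997c1
  obtain ⟨f₀, hf₀⟩ := exists_newform_997c1 hnf
  have hgF := newform_T0_eq_charTwist f₀ hf₀ g hg
  set F := charTwist 527413 dvd_527413 sq_dvd_527413 (isQuadratic_jacobiChar (q := 23)) f₀ with hFdef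
  have hF : IsNewform0 F := hgF ▸ hg.1
  have hQF : coeffField F = ⊥ := hgF ▸ hg.coeffField_eq_bot
  obtain ⟨c, hc, -⟩ := exists_rat_forall_ratPlusSymbol_charTwist_eq_of_odd 527413 dvd_527413 sq_dvd_527413
    (isQuadratic_jacobiChar (q := 23)) jacobiChar_23_odd jacobiChar_23_isPrimitive hf₀.1
    hf₀.coeffField_eq_bot hF hQF (fun u : ZMod 23 => jacobiSym (u.val : ℤ) 23) (fun u => jacobiChar_apply u)
  obtain ⟨K₀, hK₀all, hK₀val⟩ := exists_ratMinusSymbol_const f₀ hf₀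
  refine ⟨c * K₀, fun r => ?_, fun a ha hac => ?_⟩
  · choose k hk using hK₀all
    refine ⟨∑ u : ZMod 23, jacobiSym (u.val : ℤ) 23 * k (r + twistShift u), ?_⟩
    rw [hgF, hc r]
    push_cast
    rw [Finset.mul_sum, Finset.mul_sum]
    refine Finset.sum_congr rfl fun u _ => ?_
    rw [hk (r + twistShift u)]
    ring
  · rw [hgF, hc ((a : ℚ) / 239)]
    have hterm : ∀ u : ZMod 23, (jacobiSym (u.val : ℤ) 23 : ℚ) * ratMinusSymbol f₀ ((a : ℚ) / 239 + twistShift u) =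
        K₀ * ((if u.val = 0 then 0 else jac23 u.val * chainSum 997 phim997c1 5498 5497 (bezT a u.val) : ℤ) : ℚ) := by
      intro u
      have hu23 : u.val < 23 := ZMod.val_lt u
      by_cases hu : u.val = 0
      · rw [hu, if_pos rfl]
        simp [jacobiSym.zero_left]
      · rw [if_neg hu, jac23_eq u.val hu23]
        have hbez := bezout_5497 a ha hac u.val hu23 hu
        have hval := hK₀val ((23 * a + 239 * u.val : ℕ) : ℤ) (bezT a u.val) 5497 (by norm_num) hbez 5498 (by norm_num)
        have hr : (a : ℚ) / 239 + twistShift u = (((23 * a + 239 * u.val : ℕ) : ℤ) : ℚ) / (5497 : ℕ) := by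
          rw [twistShift]
          push_cast
          field_simp
          ring
        rw [hr, hval]
        push_cast
        ring
    rw [Finset.sum_congr rfl fun u _ => hterm u, ← Finset.mul_sum, sigmaT, Int.cast_sum]
    ring

end Summit.BirchSwinnertonDyer.BirchSwinnertonDyer.Theorems.KolyvaginDepthDoor.MSymbolCert.Cert997c1

end
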